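import Literature.Algebra.GroupRings.CharpolyQuotientRankTwoModules
import Mathlib.LinearAlgebra.TensorProduct.Tower
import Mathlib.LinearAlgebra.Dimension.Constructions
import Mathlib.LinearAlgebra.Dimension.Finite
import Mathlib.LinearAlgebra.Dimension.Free
import Mathlib.LinearAlgebra.FiniteDimensional.Lemmas
import Mathlib.RingTheory.TensorProduct.Finite
import Mathlib.Tactic
import HarnessLib

/-!
# Boston–Lenstra–Ribet over a field of definition of the traces; the multiplicity-one assembly

Companion of `CharpolyQuotientRankTwo.lean` / `CharpolyQuotientRankTwoModules.lean` (Boston–Lenstra–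
Ribet 1991, Thm. 1 [BostonLenstraRibet1991], ring and module form). In the arithmetic applications
(Mazur 1977 Prop. II.14.2; Buzzard 2000 [Buzzard2000LevelLoweringModTwo] Lemma 2.3 and the proof of
Prop. 2.4, p. 101; Ribet–Stein [RibetStein2008] §3.3 and Buzzard's appendix Thm. 6.1) the module is
`J(Γ)[𝔪]`, a vector space over the RESIDUE FIELD `F = 𝕋/𝔪` of the Hecke algebra, while the
absolutely irreducible `ρ ≅ ρ_𝔪` lives over an algebraically closed `k ⊇ F` (an embedding
`ι : 𝕋/𝔪 → k`; this is exactly the quantifier shape of the tree's cited fact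
`Literature.NumberTheory.EllipticCurves.ModularForms.buzzard2000_multiplicityOne_gamma0`). This file
supplies the purely algebraic glue between the two:

* §1 `charpolyRel_conj`, `exists_charpolyRel_of_conj_cover` — the rank-two Cayley–Hamilton relation
  `σ(g)² - t σ(g) + n = 0` is stable under conjugation, and `tr ρ`, `det ρ` are class functions; so
  relations known on a set of representatives of the conjugacy classes (in the application: the
  Frobenius elements, by Chebotarev and the Eichler–Shimura relation) hold for every `g`
  (any commutative `F`, `k`).
* §2 descent (`F ⊆ k` fields): a representation `σ` of `G` on an `F`-space `M` with
  `σ(g)² - t(g) σ(g) + n(g) = 0`, `t(g) ↦ tr ρ(g)`, `n(g) ↦ det ρ(g)` under `F → k`, base-changes to a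
  `k`-representation on `k ⊗_F M` satisfying the hypotheses of [BLR] for `ρ`
  (`exists_baseChange_of_charpolyRel`); hence the conclusions of the companion files descend to `F`:
  no abelian action (`subsingleton_of_charpolyRel_of_commute_descent`, and its submodule form
  `eq_bot_of_charpolyRel_of_commute_on` — "a `σ`-stable subspace on which `G` acts through an abelian
  quotient is `0`", the use of Buzzard's Lemma 2.3 in the proof of his Prop. 2.4), and the
  multiplicity count `dim_F M = 2·m` (`exists_finrank_eq_two_mul_of_charpolyRel_descent`).
* §3 the assembly of Buzzard 2000, proof of Prop. 2.4 (p. 101), with the geometric carriers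
  abstracted: if `π : M → M₁` is `F`-linear with `σ`-stable kernel on which `G` acts through an
  abelian quotient (print: `π = π^* : J₀(N)[𝔪] → J₁(N)[𝔪]`, Lemma 2.3 ⟸ Ling–Oesterlé), if
  `dim_F M₁ ≤ 2` (print: Thm. 6.1 of the appendix / Edixhoven 1992 Thm. 9.2 on `J₁(N)`) and
  `0 < dim_F M` (print: "`J₀(N)[𝔪] ≠ 0`"; tree: `J0.finrank_torsionBySet_pos`), then `π` is injective
  and `dim_F M = 2` (`finrank_eq_two_of_charpolyRel_of_commute_on_ker`), indeed `π` is bijective when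
  `dim_F M₁ = 2` (`bijective_of_charpolyRel_of_commute_on_ker`).
* §4 the same statements over `k` itself (`t = tr ∘ ρ`, `n = det ∘ ρ`), for consumers whose module
  is already a `k`-space.

Nothing is defined here (theorems only); the base-changed representation is produced as an
existential with its defining equation `τ g = (σ g).baseChange k`, so no new carrier is minted.
What is deliberately NOT here: any modular-curve object — `J₀(N)`, `J₁(N)`, the Galois action on
their torsion, the Eichler–Shimura relation, Chebotarev — these are the inputs `X₁`, `X₂` and the
Galois datum of the eventual proof of `buzzard2000_multiplicityOne_gamma0`, which feed §3 verbatim.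

## References
* N. Boston, H. W. Lenstra, K. A. Ribet, C. R. Acad. Sci. Paris Sér. I 312 (1991) 323–328
  [BostonLenstraRibet1991], Thm. 1.
* K. Buzzard, On level-lowering for mod 2 representations, Math. Res. Lett. 7 (2000) 95–110
  [Buzzard2000LevelLoweringModTwo], Lemma 2.3 and the proof of Prop. 2.4 (p. 101).
* K. Ribet, W. Stein, Lectures on Serre's conjectures [RibetStein2008], §3.3; appendix by
  K. Buzzard, Thm. 6.1.
-/

namespace Literature.Algebra.GroupRings

open MonoidAlgebra
open scoped TensorProduct

/-! ### §1. Conjugation invariance of the rank-two relations -/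

section Conjugation

variable {F : Type*} [CommRing F] {G : Type*} [Group G] {M : Type*} [AddCommGroup M] [Module F M]

/-- **The rank-two Cayley–Hamilton relation is stable under conjugation.** If
`σ(c)² - t σ(c) + n = 0` on `M`, then the same relation (same `t`, `n`) holds for `σ(h c h⁻¹)`,
since `σ(h c h⁻¹) = σ(h) σ(c) σ(h)⁻¹`. This is the algebra behind transporting the Eichler–Shimura
relations from the Frobenius conjugacy classes `[Frob_p]` to all of `Gal(F/ℚ)` by Chebotarev's
theorem in its conjugacy-class form (Darmon–Diamond–Taylor Thm. 2.3, used in §4.5, p. 135).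
[cite: DarmonDiamondTaylor1995, Thm. 2.3 (Chebotarev, classes `[Frob_p]`) with §4.5 p. 135] -/
theorem charpolyRel_conj (σ : Representation F G M) {c : G} {t n : F}
    (hc : σ c * σ c - t • σ c + n • (1 : Module.End F M) = 0) (h : G) :
    σ (h * c * h⁻¹) * σ (h * c * h⁻¹) - t • σ (h * c * h⁻¹) + n • (1 : Module.End F M) = 0 := by
  have h1 : σ h⁻¹ * σ h = 1 := by rw [← map_mul, inv_mul_cancel, map_one]
  have h2 : σ h * σ h⁻¹ = 1 := by rw [← map_mul, mul_inv_cancel, map_one]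
  have e1 : σ h * σ c * σ h⁻¹ * (σ h * σ c * σ h⁻¹) = σ h * (σ c * σ c) * σ h⁻¹ := by
    calc σ h * σ c * σ h⁻¹ * (σ h * σ c * σ h⁻¹)
        = σ h * σ c * (σ h⁻¹ * σ h) * σ c * σ h⁻¹ := by simp only [mul_assoc]
      _ = σ h * (σ c * σ c) * σ h⁻¹ := by rw [h1, mul_one]; simp only [mul_assoc]
  calc σ (h * c * h⁻¹) * σ (h * c * h⁻¹) - t • σ (h * c * h⁻¹) + n • (1 : Module.End F M)
      = σ h * (σ c * σ c) * σ h⁻¹ - t • (σ h * σ c * σ h⁻¹) + n • (σ h * σ h⁻¹) := by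
        rw [map_mul, map_mul, e1, h2]
    _ = σ h * (σ c * σ c - t • σ c + n • (1 : Module.End F M)) * σ h⁻¹ := by
        rw [mul_add, add_mul, mul_sub, sub_mul, mul_smul_comm, smul_mul_assoc, mul_smul_comm,
          smul_mul_assoc, mul_one]
    _ = 0 := by rw [hc, mul_zero, zero_mul]

variable {k : Type*} [CommRing k] [Algebra F k]

/-- **Relations on conjugacy-class representatives suffice** (the shape in which Chebotarev's
density theorem and the Eichler–Shimura relation feed [BLR]: every element of the finite Galois
group is conjugate to a Frobenius at an unramified prime, where the relation is known). Let
`ρ : G → M₂(k)` be multiplicative, `F → k` a commutative algebra, `σ` an `F`-linear representation,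
and `S ⊆ G` a set meeting every conjugacy class. If for `c ∈ S` one has
`σ(c)² - t(c) σ(c) + n(c) = 0` with `t(c) ↦ tr ρ(c)`, `n(c) ↦ det ρ(c)`, then such data exist for
EVERY `g ∈ G` (trace and determinant being class functions). In print: Darmon–Diamond–Taylor,
Thm. 2.3 ("`⋃_{p ∉ S} [Frob_p]` is dense in `Gal(F/ℚ)`", i.e. for finite `F/ℚ` every element lies
in some class `[Frob_p]`) feeding the argument of §4.5, p. 135 ("by the argument in [Maz1]
prop. II.14.2 or by the main result of [BLR]").
[cite: DarmonDiamondTaylor1995, Thm. 2.3 (Chebotarev, classes `[Frob_p]`) with §4.5 p. 135] -/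
theorem exists_charpolyRel_of_conj_cover (ρ : G →* Matrix (Fin 2) (Fin 2) k)
    (σ : Representation F G M) (S : Set G)
    (hS : ∀ g : G, ∃ c ∈ S, ∃ h : G, g = h * c * h⁻¹) (t n : G → F)
    (hrel : ∀ c ∈ S, σ c * σ c - t c • σ c + n c • (1 : Module.End F M) = 0)
    (ht : ∀ c ∈ S, algebraMap F k (t c) = (ρ c).trace)
    (hn : ∀ c ∈ S, algebraMap F k (n c) = (ρ c).det) :
    ∃ t' n' : G → F, ∀ g : G, algebraMap F k (t' g) = (ρ g).trace ∧
      algebraMap F k (n' g) = (ρ g).det ∧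
      σ g * σ g - t' g • σ g + n' g • (1 : Module.End F M) = 0 := by
  choose c hcS h hg using hS
  refine ⟨fun g => t (c g), fun g => n (c g), fun g => ?_⟩
  show algebraMap F k (t (c g)) = (ρ g).trace ∧ algebraMap F k (n (c g)) = (ρ g).det ∧
    σ g * σ g - t (c g) • σ g + n (c g) • (1 : Module.End F M) = 0
  set c₀ := c g with hc₀
  set h₀ := h g with hh₀
  have hc₀S : c₀ ∈ S := hcS g
  have e : g = h₀ * c₀ * h₀⁻¹ := hg g
  clear_value c₀ h₀
  refine ⟨?_, ?_, ?_⟩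
  · rw [ht c₀ hc₀S]
    conv_rhs => rw [e, map_mul, map_mul, Matrix.trace_mul_cycle]
    rw [← map_mul, ← map_mul, inv_mul_cancel, one_mul]
  · rw [hn c₀ hc₀S]
    conv_rhs => rw [e, map_mul, map_mul, Matrix.det_mul, Matrix.det_mul]
    rw [mul_comm (ρ h₀).det, mul_assoc, ← Matrix.det_mul, ← map_mul, mul_inv_cancel, map_one,
      Matrix.det_one, mul_one]
  · rw [e]
    exact charpolyRel_conj σ (hrel c₀ hc₀S) h₀

end Conjugation

/-! ### §2. Descent of [BLR]'s conclusions to a field of definition of the traces -/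

section Descent

variable {F : Type*} [Field F] {k : Type*} [Field k] [Algebra F k] {G : Type*} [Group G]
  {M : Type*} [AddCommGroup M] [Module F M]

/-- **Base change of a representation satisfying rank-two Cayley–Hamilton relations.** Let
`F → k` be fields, `σ` an `F`-linear representation of `G` on `M` with
`σ(g)² - t(g) σ(g) + n(g) = 0`, and `ρ : G → M₂(k)` multiplicative with `tr ρ(g) = t(g)`,
`det ρ(g) = n(g)` (read in `k`). Then `g ↦ σ(g) ⊗ 1` is a `k`-linear representation `τ` of `G` on
`k ⊗_F M` satisfying `τ(g)² - tr ρ(g) τ(g) + det ρ(g) = 0`, i.e. the hypothesis of [BLR, Thm. 1].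
(Stated as an existential with the defining equation `τ g = (σ g).baseChange k`; nothing is
defined.) In print the module is a `𝕋/𝔪`-vector space while `ρ_𝔪` is taken over `𝔽̄_ℓ`:
Darmon–Diamond–Taylor §4.5, p. 135, "the action of `G_ℚ` on … this `T/m`-vector space … by the
argument in [Maz1] prop. II.14.2 or by the main result of [BLR]"; Buzzard 2000 Def. 2.2, "after
some choice of embedding `T/m → 𝔽̄₂`".
[cite: DarmonDiamondTaylor1995, §4.5 p. 135 (the [BLR] step on the `𝕋/𝔪`-vector space `V`)] -/
theorem exists_baseChange_of_charpolyRel (ρ : G →* Matrix (Fin 2) (Fin 2) k)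
    (σ : Representation F G M) (t n : G → F)
    (ht : ∀ g : G, algebraMap F k (t g) = (ρ g).trace)
    (hn : ∀ g : G, algebraMap F k (n g) = (ρ g).det)
    (hσ : ∀ g : G, σ g * σ g - t g • σ g + n g • (1 : Module.End F M) = 0) :
    ∃ τ : Representation k G (k ⊗[F] M), (∀ g : G, τ g = (σ g).baseChange k) ∧
      ∀ g : G, τ g * τ g - (ρ g).trace • τ g + (ρ g).det • (1 : Module.End k (k ⊗[F] M)) = 0 := by
  refine ⟨⟨⟨fun g => (σ g).baseChange k, ?_⟩, ?_⟩, fun g => rfl, fun g => ?_⟩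
  · show (σ 1).baseChange k = 1
    rw [map_one]
    exact LinearMap.baseChange_one F M
  · intro g g'
    show (σ (g * g')).baseChange k = (σ g).baseChange k * (σ g').baseChange k
    rw [map_mul]
    exact LinearMap.baseChange_mul _ _
  · show (σ g).baseChange k * (σ g).baseChange k - (ρ g).trace • (σ g).baseChange k
        + (ρ g).det • (1 : Module.End k (k ⊗[F] M)) = 0
    refine TensorProduct.AlgebraTensorModule.ext fun a x => ?_
    have hx : σ g (σ g x) - t g • σ g x + n g • x = 0 := by
      simpa using congrArg (fun f : Module.End F M => f x) (hσ g)
    simp only [LinearMap.add_apply, LinearMap.sub_apply, LinearMap.smul_apply, Module.End.mul_apply,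
      Module.End.one_apply, LinearMap.baseChange_tmul, LinearMap.zero_apply, ← ht, ← hn]
    rw [algebraMap_smul, algebraMap_smul, ← TensorProduct.tmul_smul, ← TensorProduct.tmul_smul,
      ← TensorProduct.tmul_sub, ← TensorProduct.tmul_add, hx, TensorProduct.tmul_zero]

/-- **No abelian action, over the field of definition of the traces** (the use of [BLR] in Buzzard
2000, Lemma 2.3 / proof of Prop. 2.4, and in Mazur's argument): with `F → k` fields,
`ρ : G → M₂(k)` multiplicative with `lift ρ : k[G] → M₂(k)` onto (absolute irreducibility), and
`σ` an `F`-linear representation with `σ(g)² - t(g) σ(g) + n(g) = 0`, `t ↦ tr ρ`, `n ↦ det ρ`: if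
the `σ(g)` pairwise commute (`G` acts through an abelian quotient) then `M = 0`. (Base change to
`k`, `subsingleton_of_charpolyRel_of_commute`, and `dim_k (k ⊗_F M) = dim_F M`.)
[cite: BostonLenstraRibet1991, Thm. 1] -/
theorem subsingleton_of_charpolyRel_of_commute_descent (ρ : G →* Matrix (Fin 2) (Fin 2) k)
    (hρ : Function.Surjective (MonoidAlgebra.lift k (Matrix (Fin 2) (Fin 2) k) G ρ))
    (σ : Representation F G M) (t n : G → F)
    (ht : ∀ g : G, algebraMap F k (t g) = (ρ g).trace)
    (hn : ∀ g : G, algebraMap F k (n g) = (ρ g).det)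
    (hσ : ∀ g : G, σ g * σ g - t g • σ g + n g • (1 : Module.End F M) = 0)
    (hcomm : ∀ g h : G, Commute (σ g) (σ h)) : Subsingleton M := by
  obtain ⟨τ, hτ, hτrel⟩ := exists_baseChange_of_charpolyRel ρ σ t n ht hn hσ
  have hcommτ : ∀ g h : G, Commute (τ g) (τ h) := fun g h => by
    show τ g * τ h = τ h * τ g
    rw [hτ g, hτ h, ← LinearMap.baseChange_mul, (hcomm g h).eq, LinearMap.baseChange_mul]
  haveI : Subsingleton (k ⊗[F] M) := subsingleton_of_charpolyRel_of_commute ρ hρ τ hτrel hcommτ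
  have h0 : Module.rank F M = 0 := by
    have e := Module.rank_baseChange (R := k) (S := F) (M' := M)
    rw [rank_subsingleton'] at e
    exact Cardinal.lift_eq_zero.mp e.symm
  exact rank_zero_iff.mp h0

/-- **Submodule form** (exactly how Buzzard 2000 uses Lemma 2.3 in the proof of Prop. 2.4, p. 101:
"an irreducible `ρ` has no non-zero subquotient on which Galois acts through an abelian quotient"):
under the hypotheses of `subsingleton_of_charpolyRel_of_commute_descent` on `σ`, every `σ`-stable
`F`-subspace `U ≤ M` on which the `σ(g)` commute is `0`.
[cite: Buzzard2000LevelLoweringModTwo, Lemma 2.3 and proof of Prop. 2.4 (p. 101)] -/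
theorem eq_bot_of_charpolyRel_of_commute_on (ρ : G →* Matrix (Fin 2) (Fin 2) k)
    (hρ : Function.Surjective (MonoidAlgebra.lift k (Matrix (Fin 2) (Fin 2) k) G ρ))
    (σ : Representation F G M) (t n : G → F)
    (ht : ∀ g : G, algebraMap F k (t g) = (ρ g).trace)
    (hn : ∀ g : G, algebraMap F k (n g) = (ρ g).det)
    (hσ : ∀ g : G, σ g * σ g - t g • σ g + n g • (1 : Module.End F M) = 0)
    (U : Submodule F M) (hU : ∀ (g : G), ∀ x ∈ U, σ g x ∈ U)
    (hcomm : ∀ (g h : G), ∀ x ∈ U, σ g (σ h x) = σ h (σ g x)) : U = ⊥ := by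
  let σU : Representation F G U :=
    { toFun := fun g => (σ g).restrict (hU g)
      map_one' := by
        apply LinearMap.ext
        intro x
        apply Subtype.ext
        simp
      map_mul' := fun g h => by
        apply LinearMap.ext
        intro x
        apply Subtype.ext
        simp }
  have hσU_apply : ∀ (g : G) (x : U), ((σU g x : U) : M) = σ g x := fun g x => rfl
  have hσU : ∀ g : G, σU g * σU g - t g • σU g + n g • (1 : Module.End F U) = 0 := by
    intro g
    apply LinearMap.ext
    intro x
    apply Subtype.ext
    have hx : σ g (σ g x) - t g • σ g x + n g • (x : M) = 0 := by
      simpa using congrArg (fun f : Module.End F M => f x) (hσ g)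
    simpa [hσU_apply] using hx
  have hcommU : ∀ g h : G, Commute (σU g) (σU h) := by
    intro g h
    show σU g * σU h = σU h * σU g
    apply LinearMap.ext
    intro x
    apply Subtype.ext
    simpa [hσU_apply] using hcomm g h x x.2
  haveI : Subsingleton U :=
    subsingleton_of_charpolyRel_of_commute_descent ρ hρ σU t n ht hn hσU hcommU
  rw [Submodule.eq_bot_iff]
  intro x hx
  have := Subsingleton.elim (⟨x, hx⟩ : U) 0
  simpa using congrArg Subtype.val this

/-- **Multiplicity count over the field of definition** (Ribet–Stein §3.3, "`dim J[𝔪] = 2t`",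
with `J[𝔪]` a `𝕋/𝔪`-space and `ρ_𝔪` over `𝔽̄_ℓ`): under the hypotheses of
`subsingleton_of_charpolyRel_of_commute_descent` on `σ` (without commutativity), a
finite-dimensional `M` has EVEN `F`-dimension `2·m`. [cite: BostonLenstraRibet1991, Thm. 1] -/
theorem exists_finrank_eq_two_mul_of_charpolyRel_descent (ρ : G →* Matrix (Fin 2) (Fin 2) k)
    (hρ : Function.Surjective (MonoidAlgebra.lift k (Matrix (Fin 2) (Fin 2) k) G ρ))
    (σ : Representation F G M) (t n : G → F)
    (ht : ∀ g : G, algebraMap F k (t g) = (ρ g).trace)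
    (hn : ∀ g : G, algebraMap F k (n g) = (ρ g).det)
    (hσ : ∀ g : G, σ g * σ g - t g • σ g + n g • (1 : Module.End F M) = 0)
    [Module.Finite F M] : ∃ m : ℕ, Module.finrank F M = 2 * m := by
  obtain ⟨τ, hτ, hτrel⟩ := exists_baseChange_of_charpolyRel ρ σ t n ht hn hσ
  obtain ⟨m, hm⟩ := exists_finrank_eq_two_mul_of_charpolyRel ρ hρ τ hτrel
  exact ⟨m, by rw [← hm, Module.finrank_baseChange]⟩

/-! ### §3. The assembly of Buzzard 2000, proof of Prop. 2.4 (carriers abstracted) -/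

variable {M₁ : Type*} [AddCommGroup M₁] [Module F M₁]

/-- **Injectivity of a `G`-map whose kernel carries an abelian action** (Buzzard 2000, proof of
Prop. 2.4: `J₀(N)[𝔪] → J₁(N)[𝔪]` is injective because Galois acts on the kernel of
`J₀(N) → J₁(N)` through an abelian quotient — Lemma 2.3 — while `J₀(N)[𝔪] ≅ ρ^d` with `ρ`
irreducible): under the hypotheses of `subsingleton_of_charpolyRel_of_commute_descent` on `σ`, an
`F`-linear `π : M → M₁` whose kernel is `σ`-stable and carries a commutative `σ`-action has
trivial kernel. [cite: Buzzard2000LevelLoweringModTwo, proof of Prop. 2.4 (p. 101)] -/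
theorem ker_eq_bot_of_charpolyRel_of_commute_on_ker (ρ : G →* Matrix (Fin 2) (Fin 2) k)
    (hρ : Function.Surjective (MonoidAlgebra.lift k (Matrix (Fin 2) (Fin 2) k) G ρ))
    (σ : Representation F G M) (t n : G → F)
    (ht : ∀ g : G, algebraMap F k (t g) = (ρ g).trace)
    (hn : ∀ g : G, algebraMap F k (n g) = (ρ g).det)
    (hσ : ∀ g : G, σ g * σ g - t g • σ g + n g • (1 : Module.End F M) = 0)
    (π : M →ₗ[F] M₁) (hπ : ∀ (g : G) (x : M), π x = 0 → π (σ g x) = 0)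
    (hcomm : ∀ (g h : G) (x : M), π x = 0 → σ g (σ h x) = σ h (σ g x)) :
    LinearMap.ker π = ⊥ :=
  eq_bot_of_charpolyRel_of_commute_on ρ hρ σ t n ht hn hσ (LinearMap.ker π)
    (fun g x hx => LinearMap.mem_ker.mpr (hπ g x (LinearMap.mem_ker.mp hx)))
    (fun g h x hx => hcomm g h x (LinearMap.mem_ker.mp hx))

/-- **Buzzard 2000, proof of Prop. 2.4 — the assembly, in kernel form with the modular-curve
carriers abstracted.** Fields `F → k` (`F = 𝕋/𝔪`, `k = 𝔽̄₂`); `ρ : G → M₂(k)` multiplicative with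
`lift ρ` onto (absolute irreducibility, Burnside form; from `Representation.IsIrreducible` by
`lift_surjective_of_isIrreducible`); `σ` an `F`-linear representation of `G` on `M` (`= J₀(N)[𝔪]`)
with `σ(g)² - t(g)σ(g) + n(g) = 0`, `t ↦ tr ρ`, `n ↦ det ρ` (Eichler–Shimura + Chebotarev);
`π : M → M₁` (`= π^* : J₀(N)[𝔪] → J₁(N)[𝔪]`) `F`-linear with `σ`-stable kernel on which `G` acts
through an abelian quotient (Lemma 2.3); `dim_F M₁ ≤ 2` (appendix Thm. 6.1 / Edixhoven Thm. 9.2);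
`0 < dim_F M` ("`J₀(N)[𝔪] ≠ 0`"). THEN `π` is injective and `dim_F M = 2` — multiplicity one.
Proof: `ker π = 0` (`ker_eq_bot_of_charpolyRel_of_commute_on_ker`), so `dim M ≤ dim M₁ ≤ 2`; and
`dim M = 2m > 0` (`exists_finrank_eq_two_mul_of_charpolyRel_descent`).
[cite: Buzzard2000LevelLoweringModTwo, proof of Prop. 2.4 (p. 101)] -/
theorem finrank_eq_two_of_charpolyRel_of_commute_on_ker (ρ : G →* Matrix (Fin 2) (Fin 2) k)
    (hρ : Function.Surjective (MonoidAlgebra.lift k (Matrix (Fin 2) (Fin 2) k) G ρ))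
    (σ : Representation F G M) (t n : G → F)
    (ht : ∀ g : G, algebraMap F k (t g) = (ρ g).trace)
    (hn : ∀ g : G, algebraMap F k (n g) = (ρ g).det)
    (hσ : ∀ g : G, σ g * σ g - t g • σ g + n g • (1 : Module.End F M) = 0)
    (π : M →ₗ[F] M₁) (hπ : ∀ (g : G) (x : M), π x = 0 → π (σ g x) = 0)
    (hcomm : ∀ (g h : G) (x : M), π x = 0 → σ g (σ h x) = σ h (σ g x))
    [Module.Finite F M₁] (h₁ : Module.finrank F M₁ ≤ 2) (h0 : 0 < Module.finrank F M) :
    Function.Injective π ∧ Module.finrank F M = 2 := by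
  have hinj : Function.Injective π :=
    LinearMap.ker_eq_bot.mp (ker_eq_bot_of_charpolyRel_of_commute_on_ker ρ hρ σ t n ht hn hσ π hπ hcomm)
  haveI : Module.Finite F M := Module.finite_of_finrank_pos h0
  have hle : Module.finrank F M ≤ Module.finrank F M₁ :=
    LinearMap.finrank_le_finrank_of_injective hinj
  obtain ⟨m, hm⟩ := exists_finrank_eq_two_mul_of_charpolyRel_descent ρ hρ σ t n ht hn hσ
  exact ⟨hinj, by omega⟩

/-- **Corollary: `π` is an isomorphism when `dim_F M₁ = 2`** (in print: `J₀(N)[𝔪] ≅ J₁(N)[𝔪]` under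
`π^*`). Same hypotheses as `finrank_eq_two_of_charpolyRel_of_commute_on_ker` with
`dim_F M₁ = 2`. [cite: Buzzard2000LevelLoweringModTwo, proof of Prop. 2.4 (p. 101)] -/
theorem bijective_of_charpolyRel_of_commute_on_ker (ρ : G →* Matrix (Fin 2) (Fin 2) k)
    (hρ : Function.Surjective (MonoidAlgebra.lift k (Matrix (Fin 2) (Fin 2) k) G ρ))
    (σ : Representation F G M) (t n : G → F)
    (ht : ∀ g : G, algebraMap F k (t g) = (ρ g).trace)
    (hn : ∀ g : G, algebraMap F k (n g) = (ρ g).det)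
    (hσ : ∀ g : G, σ g * σ g - t g • σ g + n g • (1 : Module.End F M) = 0)
    (π : M →ₗ[F] M₁) (hπ : ∀ (g : G) (x : M), π x = 0 → π (σ g x) = 0)
    (hcomm : ∀ (g h : G) (x : M), π x = 0 → σ g (σ h x) = σ h (σ g x))
    [Module.Finite F M₁] (h₁ : Module.finrank F M₁ = 2) (h0 : 0 < Module.finrank F M) :
    Function.Bijective π := by
  obtain ⟨hinj, h2⟩ :=
    finrank_eq_two_of_charpolyRel_of_commute_on_ker ρ hρ σ t n ht hn hσ π hπ hcomm h₁.le h0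
  haveI : Module.Finite F M := Module.finite_of_finrank_pos h0
  exact ⟨hinj,
    (LinearMap.injective_iff_surjective_of_finrank_eq_finrank (h2.trans h₁.symm)).mp hinj⟩

end Descent

/-! ### §4. The same statements over `k` itself -/

section OverK

variable {k : Type*} [Field k] {G : Type*} [Group G] {M : Type*} [AddCommGroup M] [Module k M]
  {M₁ : Type*} [AddCommGroup M₁] [Module k M₁]

/-- **Submodule form of "no abelian action", over `k`**: with `lift ρ : k[G] → M₂(k)` onto and
`σ(g)² - tr ρ(g) σ(g) + det ρ(g) = 0` on the `k`-space `M`, every `σ`-stable subspace on which the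
`σ(g)` commute is `0`. (`eq_bot_of_charpolyRel_of_commute_on` with `F = k`.)
[cite: Buzzard2000LevelLoweringModTwo, Lemma 2.3 and proof of Prop. 2.4 (p. 101)] -/
theorem eq_bot_of_charpolyRel_of_commute_on' (ρ : G →* Matrix (Fin 2) (Fin 2) k)
    (hρ : Function.Surjective (MonoidAlgebra.lift k (Matrix (Fin 2) (Fin 2) k) G ρ))
    (σ : Representation k G M)
    (hσ : ∀ g : G, σ g * σ g - (ρ g).trace • σ g + (ρ g).det • (1 : Module.End k M) = 0)
    (U : Submodule k M) (hU : ∀ (g : G), ∀ x ∈ U, σ g x ∈ U)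
    (hcomm : ∀ (g h : G), ∀ x ∈ U, σ g (σ h x) = σ h (σ g x)) : U = ⊥ :=
  eq_bot_of_charpolyRel_of_commute_on (F := k) ρ hρ σ (fun g => (ρ g).trace) (fun g => (ρ g).det)
    (fun _ => rfl) (fun _ => rfl) hσ U hU hcomm

/-- **The multiplicity-one assembly over `k`**: with `lift ρ : k[G] → M₂(k)` onto,
`σ(g)² - tr ρ(g) σ(g) + det ρ(g) = 0` on `M`, `π : M → M₁` `k`-linear with `σ`-stable kernel
carrying a commutative `σ`-action, `dim_k M₁ ≤ 2` and `0 < dim_k M`: `π` is injective and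
`dim_k M = 2`. (`finrank_eq_two_of_charpolyRel_of_commute_on_ker` with `F = k`.)
[cite: Buzzard2000LevelLoweringModTwo, proof of Prop. 2.4 (p. 101)] -/
theorem finrank_eq_two_of_charpolyRel_of_commute_on_ker' (ρ : G →* Matrix (Fin 2) (Fin 2) k)
    (hρ : Function.Surjective (MonoidAlgebra.lift k (Matrix (Fin 2) (Fin 2) k) G ρ))
    (σ : Representation k G M)
    (hσ : ∀ g : G, σ g * σ g - (ρ g).trace • σ g + (ρ g).det • (1 : Module.End k M) = 0)
    (π : M →ₗ[k] M₁) (hπ : ∀ (g : G) (x : M), π x = 0 → π (σ g x) = 0)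
    (hcomm : ∀ (g h : G) (x : M), π x = 0 → σ g (σ h x) = σ h (σ g x))
    [Module.Finite k M₁] (h₁ : Module.finrank k M₁ ≤ 2) (h0 : 0 < Module.finrank k M) :
    Function.Injective π ∧ Module.finrank k M = 2 :=
  finrank_eq_two_of_charpolyRel_of_commute_on_ker (F := k) ρ hρ σ (fun g => (ρ g).trace)
    (fun g => (ρ g).det) (fun _ => rfl) (fun _ => rfl) hσ π hπ hcomm h₁ h0

end OverK

end Literature.Algebra.GroupRings
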